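import Literature.Barriers.CriticalPhenomena.RigorousRGSmallParameterTorusCovarianceBound
import Literature.Barriers.CriticalPhenomena.RigorousRGSmallParameterCovarianceGradientBound
import HarnessLib

/-!
# `RigorousRGSmallParameter` (Slade, Theorem 1.4.1): the estimate (3.10) with discrete
# gradients `∇^a` on the torus term `C_{N,N}` (Proposition 3.3.1)

Companion of `RigorousRGSmallParameterTorusCovarianceBound.lean` (the case `a = 0`) and
`RigorousRGSmallParameterCovarianceGradientBound.lean` ((3.9) with `∇^a`, absolute value inside the
`s`-integral) in the proof architecture of the barrier `RigorousRGSmallParameter.lean`. Source: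
G. Slade, *Critical exponents for long-range `O(n)` models below the upper critical dimension*,
Commun. Math. Phys. 358 (2018) 343–436, Proposition 3.3.1: "For `m² ∈ (0,m̄²]`, (3.10)
`|∇^aC_{N,N;x,y}| ≤ cL^{-(d-α+|a|)(N-1)} (m²L^{α(N-1)})^{-2}`. The constant `c` may depend on
`m̄², ā`, but does not depend on `m², L, j, N`", with its proof in §10.1 ("Assuming (10.3), we
obtain (10.4) easily, as follows. By definition, `C_{N,N;x,y} = Σ_{z∈ℤ^d}Σ_{j=N}^∞C_{j;x,y+zL^N}`
… by the finite-range property of `C_j`, `|∇^aC_{N,N;x,y}| ≲ Σ_{j=N}^∞ L^{d(j-N)}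
L^{-(j-1)(d-α+|a|)}(1+m⁴L^{2α(j-1)})⁻¹ ≤ … ≲ m⁻⁴L^{-(N-1)(d+α+|a|)}`"). The torus gradient in `x`
is the lattice gradient of the `L^N`-periodic lift `a ↦ C_{N,N}(π(a),y)` (`π : ℤ^d → Λ_N` the
projection), which is how it is stated here.

## What this file proves (everything; no definition and no named fact is introduced)

* `FRD.latGrad_shift`, `FRD.latGrad_tsum`, `FRD.measurable_latGrad`, `FRD.latGrad_eq_zero_of_le`
  — generic facts on iterated lattice gradients (translation covariance, commuting with sums,
  measurability in a parameter, finite range enlarged by the number of steps).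
* `FRD.periodise_proj_eq` — for a translation-invariant kernel,
  `K^Λ(π(a),y) = Σ_z k(a-ỹ-Mz)` for every `a ∈ ℤ^d` (independence of the representative).
* `FRD.latGrad_GamNN_proj`, `FRD.latGrad_GamTail`, `FRD.ofReal_abs_latGrad_GamNN_le`,
  `FRD.lintegral_abs_latGrad_GamNN_mul_le` — `|∇^lΓ_{N,N}(π(·),y)(a)| ≤ Σ_zΣ_{j≥N}|∇^lΓ_j(a-ỹ-Mz)|`
  and the Tonelli interchange with the `s`-integral.
* `FRD.card_translates_lt_le` — at most `(2r/M+1)^d` translates `z` with `|w-Mz|₁ < r`.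
* **`FRD.Slade2017_prop331_CNN_grad_estimate`** — **(3.10) = (10.4) with `∇^a`, PROVED**: for
  `d ≥ 1`, `n`, `α ∈ (0,2∧d)`, `m̄² > 0` there is `c > 0` — independent of `m², L, N, a, y` and of
  the unit-step list `l` of length `n` — with
  `|∇^l_a C_{N,N}(π(a),y)(m²)| ≤ c (L^{N-1})^{α-d-n} (m²(L^{N-1})^α)^{-2}` for all integers `L ≥ 2`,
  `m² ∈ (0,m̄²]`, `N ≥ 1`, torus side `M = L^N`, all `a ∈ ℤ^d`, `y ∈ Λ_N`.
-/

noncomputable section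

namespace Literature.Barriers.CriticalPhenomena

open _root_.MeasureTheory Set Filter
open scoped _root_.Topology Real ENNReal

namespace LongRangePhi4

namespace FRD

open Literature.Probability.LatticeModels

variable {d : ℕ}

/-! ### Generic facts on `∇^l` -/

/-- Translation covariance: `∇^l(f(·+v))(x) = (∇^lf)(x+v)`. [folklore] -/
theorem latGrad_shift (l : List (Site d)) (f : Site d → ℝ) (v : Site d) :
    ∀ x, latGrad l (fun a => f (a + v)) x = latGrad l f (x + v) := by
  induction l with
  | nil => intro x; rfl
  | cons e l ih =>
      intro x
      simp only [latGrad_cons]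
      rw [ih (x + e), ih x, add_right_comm]

/-- `∇^l` commutes with an unconditional sum, termwise summability being preserved. [folklore] -/
theorem latGrad_tsum {ι : Type*} (l : List (Site d)) {g : Site d → ι → ℝ}
    (hg : ∀ a, Summable (g a)) :
    (∀ x, Summable fun i => latGrad l (fun a => g a i) x) ∧
      ∀ x, latGrad l (fun a => ∑' i, g a i) x = ∑' i, latGrad l (fun a => g a i) x := by
  induction l with
  | nil => exact ⟨fun x => by simpa using hg x, fun x => by simp⟩
  | cons e l ih =>
      obtain ⟨ih1, ih2⟩ := ih
      refine ⟨fun x => ?_, fun x => ?_⟩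
      · simp only [latGrad_cons]
        exact (ih1 (x + e)).sub (ih1 x)
      · simp only [latGrad_cons]
        rw [ih2 (x + e), ih2 x, ← (ih1 (x + e)).tsum_sub (ih1 x)]

/-- Measurability in a parameter: if each `s ↦ F(s)(a)` is measurable then so is
`s ↦ ∇^l(F(s))(x)`. [folklore] -/
theorem measurable_latGrad {F : ℝ → Site d → ℝ} (hF : ∀ a, Measurable fun s => F s a)
    (l : List (Site d)) : ∀ x, Measurable fun s => latGrad l (F s) x := by
  induction l with
  | nil => intro x; simpa using hF x
  | cons e l ih =>
      intro x
      simp only [latGrad_cons]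
      exact (ih (x + e)).sub (ih x)

/-- The `ℓ¹` norm drops by at most `1` under a unit step: `|a|₁ ≤ |a+e|₁ + 1` when
`Σ_i|e_i| ≤ 1`. [folklore] -/
theorem l1_le_l1_add_step (a e : Site d) (he : (∑ i, |((e i : ℤ) : ℝ)|) ≤ 1) :
    (((∑ i, (a i).natAbs : ℕ) : ℝ)) ≤ (((∑ i, ((a + e) i).natAbs : ℕ) : ℝ)) + 1 := by
  have h : ∀ i, (((a i).natAbs : ℕ) : ℝ) ≤ ((((a + e) i).natAbs : ℕ) : ℝ) + |((e i : ℤ) : ℝ)| := by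
    intro i
    have h1 : (((a i).natAbs : ℕ) : ℝ) = |((a i : ℤ) : ℝ)| := by
      rw [← Int.cast_natCast, Int.natCast_natAbs, Int.cast_abs]
    have h2 : ((((a + e) i).natAbs : ℕ) : ℝ) = |((a i : ℤ) : ℝ) + ((e i : ℤ) : ℝ)| := by
      rw [← Int.cast_natCast, Int.natCast_natAbs, Int.cast_abs, Pi.add_apply, Int.cast_add]
    rw [h1, h2]
    have := abs_add_le (((a i : ℤ) : ℝ) + ((e i : ℤ) : ℝ)) (-((e i : ℤ) : ℝ))
    rw [add_neg_cancel_right, abs_neg] at this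
    exact this
  calc (((∑ i, (a i).natAbs : ℕ) : ℝ)) = ∑ i, (((a i).natAbs : ℕ) : ℝ) := by push_cast; rfl
    _ ≤ ∑ i, (((((a + e) i).natAbs : ℕ) : ℝ) + |((e i : ℤ) : ℝ)|) := Finset.sum_le_sum fun i _ => h i
    _ = (∑ i, ((((a + e) i).natAbs : ℕ) : ℝ)) + ∑ i, |((e i : ℤ) : ℝ)| := Finset.sum_add_distrib
    _ ≤ (((∑ i, ((a + e) i).natAbs : ℕ) : ℝ)) + 1 := by push_cast; linarith

/-- **Finite range, enlarged by the steps**: if `f` vanishes where `|a|₁ ≥ R`, then `∇^lf`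
vanishes where `|a|₁ ≥ R + n` (`l` a list of `n` unit steps). [folklore] -/
theorem latGrad_eq_zero_of_le {f : Site d → ℝ} {R : ℝ}
    (hf : ∀ a : Site d, R ≤ (((∑ i, (a i).natAbs : ℕ) : ℝ)) → f a = 0) (l : List (Site d))
    (hl : ∀ e ∈ l, (∑ i, |((e i : ℤ) : ℝ)|) ≤ 1) :
    ∀ a : Site d, R + l.length ≤ (((∑ i, (a i).natAbs : ℕ) : ℝ)) → latGrad l f a = 0 := by
  induction l with
  | nil => intro a ha; simpa using hf a (by simpa using ha)
  | cons e l ih =>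
      intro a ha
      have hl' : ∀ e' ∈ l, (∑ i, |((e' i : ℤ) : ℝ)|) ≤ 1 := fun e' he' => hl e' (List.mem_cons_of_mem _ he')
      have he := hl e (List.mem_cons_self ..)
      simp only [latGrad_cons]
      simp only [List.length_cons, Nat.cast_add, Nat.cast_one] at ha
      have h1 := l1_le_l1_add_step a e he
      rw [ih hl' (a + e) (by linarith), ih hl' a (by linarith), sub_zero]

/-! ### Periodised kernels at arbitrary representatives -/

/-- **Independence of the representative**: for a translation-invariant kernel `k(a-b)` with
summable rows, `K^Λ(π(a),y) = Σ_{z∈ℤ^d} k(a - ỹ - Mz)` for EVERY `a ∈ ℤ^d` projecting to the torus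
point `π(a)` (reindex `z ↦ z + ⌊a/M⌋`). [cite: Slade2017, §3.1 (display (3.3): the periodisation Σ_z K(x̃, ỹ+zL^N))] -/
theorem periodise_proj_eq {M : ℕ} [NeZero M] (k : Site d → ℝ) (a : Site d) (y : TorusSite d M) :
    periodise M (fun a b => k (a - b)) (Torus.proj M a) y =
      ∑' z : Site d, k (a - (fun j => ((y j).val : ℤ) + M * z j)) := by
  unfold periodise
  set w : Site d := fun j => a j / (M : ℤ) with hw
  have hrep : (fun j => (((Torus.proj M a) j).val : ℤ)) = fun j => a j - M * w j := by
    funext j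
    rw [Torus.proj_apply, ZMod.val_intCast, hw]
    simp only
    rw [Int.emod_def]
  rw [hrep]
  have hterm : ∀ z : Site d, k ((fun j => a j - M * w j) - fun j => ((y j).val : ℤ) + M * z j) =
      k (a - (fun j => ((y j).val : ℤ) + M * (z + w) j)) := by
    intro z
    congr 1
    funext j
    simp only [Pi.sub_apply, Pi.add_apply]
    ring
  simp_rw [hterm]
  exact (Equiv.addRight w).tsum_eq (fun z : Site d => k (a - (fun j => ((y j).val : ℤ) + M * z j)))

/-! ### `∇^lΓ_{N,N}` at representatives -/

/-- `∇^lΓ_{≥N}(c) = Σ_{m}∇^lΓ_{m+N}(c)` (termwise, `Σ_jΓ_j` converging at every point), with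
summability. [folklore] -/
theorem latGrad_GamTail {L : ℝ} (hL : 1 < L) {s : ℝ} (hs : 0 < s) (N : ℕ) (l : List (Site d)) :
    (∀ c, Summable fun m : ℕ => latGrad l (Gam d L s (m + N)) c) ∧
      ∀ c, latGrad l (GamTail d L s N) c = ∑' m : ℕ, latGrad l (Gam d L s (m + N)) c := by
  have hg : ∀ a : Site d, Summable fun m : ℕ => Gam d L s (m + N) a :=
    fun a => (hasSum_GamTail hL hs N a).summable
  have h := latGrad_tsum l hg
  have hG : GamTail d L s N = fun a => ∑' m : ℕ, Gam d L s (m + N) a := funext fun a => rfl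
  rw [hG]
  exact h

/-- **`∇^l_aΓ_{N,N}(π(a),y)(s) = Σ_z (∇^lΓ_{≥N})(a - ỹ - Mz)`**, with summability.
[cite: Slade2017, §3.1 (display (3.4)) and §10.1 (proof of (10.4), with ∇^a)] -/
theorem latGrad_GamNN_proj (hd : 1 ≤ d) {M : ℕ} [NeZero M] {L : ℝ} (hL : 1 < L) {s : ℝ}
    (hs : 0 < s) {N : ℕ} (hN : 1 ≤ N) (l : List (Site d)) (y : TorusSite d M) :
    (∀ a, Summable fun z : Site d =>
        latGrad l (GamTail d L s N) (a - (fun j => ((y j).val : ℤ) + M * z j))) ∧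
      ∀ a, latGrad l (fun b => GamNN d L s N M (Torus.proj M b) y) a =
        ∑' z : Site d, latGrad l (GamTail d L s N) (a - (fun j => ((y j).val : ℤ) + M * z j)) := by
  have hinj : Function.Injective fun z : Site d => (fun j => ((y j).val : ℤ) + M * z j : Site d) := by
    intro z₁ z₂ h
    funext j
    have hj := congr_fun h j
    simpa [NeZero.ne M] using hj
  have hg : ∀ b : Site d, Summable fun z : Site d =>
      GamTail d L s N (b - (fun j => ((y j).val : ℤ) + M * z j)) :=
    fun b => (summable_GamTail_sub hd hL hs hN b).comp_injective hinj
  obtain ⟨h1, h2⟩ := latGrad_tsum l hg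
  have hsh : ∀ (z : Site d) (a : Site d),
      latGrad l (fun b => GamTail d L s N (b - (fun j => ((y j).val : ℤ) + M * z j))) a =
      latGrad l (GamTail d L s N) (a - (fun j => ((y j).val : ℤ) + M * z j)) := by
    intro z a
    simp_rw [sub_eq_add_neg]
    exact latGrad_shift l _ _ a
  have hG : (fun b => GamNN d L s N M (Torus.proj M b) y) =
      fun b => ∑' z : Site d, GamTail d L s N (b - (fun j => ((y j).val : ℤ) + M * z j)) := by
    funext b
    unfold GamNN
    exact periodise_proj_eq (GamTail d L s N) b y
  refine ⟨fun a => ?_, fun a => ?_⟩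
  · have := h1 a
    simp_rw [hsh] at this
    exact this
  · rw [hG, h2 a]
    exact tsum_congr fun z => hsh z a

/-- **`|∇^l_aΓ_{N,N}(π(a),y)(s)| ≤ Σ_{z∈ℤ^d}Σ_{j≥N}|∇^lΓ_j(a-ỹ-Mz)(s)|`** in `ℝ≥0∞`.
[cite: Slade2017, §10.1 (proof of (10.4): "|∇^aC_{N,N;x,y}| ≲ Σ_{j=N}^∞ …")] -/
theorem ofReal_abs_latGrad_GamNN_le (hd : 1 ≤ d) {M : ℕ} [NeZero M] {L : ℝ} (hL : 1 < L) {s : ℝ}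
    (hs : 0 < s) {N : ℕ} (hN : 1 ≤ N) (l : List (Site d)) (a : Site d) (y : TorusSite d M) :
    ENNReal.ofReal |latGrad l (fun b => GamNN d L s N M (Torus.proj M b) y) a| ≤
      ∑' z : Site d, ∑' m : ℕ, ENNReal.ofReal
        |latGrad l (Gam d L s (m + N)) (a - (fun j => ((y j).val : ℤ) + M * z j))| := by
  obtain ⟨hsum, hrep⟩ := latGrad_GamNN_proj hd hL hs hN l y
  obtain ⟨hsumT, hrepT⟩ := latGrad_GamTail (d := d) hL hs N l
  rw [hrep a]
  calc ENNReal.ofReal |∑' z : Site d, latGrad l (GamTail d L s N) (a - (fun j => ((y j).val : ℤ) + M * z j))|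
      ≤ ENNReal.ofReal (∑' z : Site d,
          |latGrad l (GamTail d L s N) (a - (fun j => ((y j).val : ℤ) + M * z j))|) := by
        refine ENNReal.ofReal_le_ofReal ?_
        have := norm_tsum_le_tsum_norm (hsum a).norm
        simpa only [Real.norm_eq_abs] using this
    _ = ∑' z : Site d, ENNReal.ofReal
          |latGrad l (GamTail d L s N) (a - (fun j => ((y j).val : ℤ) + M * z j))| :=
        ENNReal.ofReal_tsum_of_nonneg (fun z => abs_nonneg _) (hsum a).abs
    _ ≤ _ := ENNReal.tsum_le_tsum fun z => ?_
  set c : Site d := a - (fun j => ((y j).val : ℤ) + M * z j) with hc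
  rw [hrepT c]
  calc ENNReal.ofReal |∑' m : ℕ, latGrad l (Gam d L s (m + N)) c|
      ≤ ENNReal.ofReal (∑' m : ℕ, |latGrad l (Gam d L s (m + N)) c|) := by
        refine ENNReal.ofReal_le_ofReal ?_
        have := norm_tsum_le_tsum_norm (hsumT c).norm
        simpa only [Real.norm_eq_abs] using this
    _ = ∑' m : ℕ, ENNReal.ofReal |latGrad l (Gam d L s (m + N)) c| :=
        ENNReal.ofReal_tsum_of_nonneg (fun m => abs_nonneg _) (hsumT c).abs

/-- `s ↦ |∇^lΓ_j(c)(s)|ρ^{(β)}(s,m²)` is integrable on `(0,∞)` (`m² > 0`). [folklore] -/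
theorem integrableOn_abs_latGrad_Gam_mul_katoDensity (hd : 1 ≤ d) {β : ℝ} (hβ0 : 0 < β)
    (hβ1 : β < 1) {L : ℝ} (hL : 1 < L) {m2 : ℝ} (hm2 : 0 < m2) {j : ℕ} (hj : 1 ≤ j)
    (l : List (Site d)) (c : Site d) :
    IntegrableOn (fun s : ℝ => |latGrad l (Gam d L s j) c| * Kato.katoDensity β m2 s) (Ioi 0) := by
  set F : Site d → ℝ → ℝ := fun b s => Gam d L s j b * Kato.katoDensity β m2 s with hF
  have hFi : ∀ b, Integrable (F b) ((volume : Measure ℝ).restrict (Ioi 0)) :=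
    fun b => integrableOn_Gam_mul_katoDensity hd hβ0 hβ1 hL hm2 hj b
  obtain ⟨h1, -⟩ := latGrad_integral hFi l
  have hpt : ∀ s : ℝ, latGrad l (fun b => F b s) c = latGrad l (Gam d L s j) c * Kato.katoDensity β m2 s := by
    intro s
    have e : (fun b => F b s) = fun b => Kato.katoDensity β m2 s * Gam d L s j b := by
      funext b
      simp only [hF]
      ring
    rw [e, latGrad_const_mul, mul_comm]
  have h2 : IntegrableOn (fun s : ℝ => latGrad l (Gam d L s j) c * Kato.katoDensity β m2 s) (Ioi 0) :=
    (h1 c).congr (Eventually.of_forall hpt)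
  refine (h2.norm).congr ?_
  refine (ae_restrict_iff' measurableSet_Ioi).2 (Eventually.of_forall fun s hs => ?_)
  have hs : (0 : ℝ) < s := hs
  simp only
  rw [Real.norm_eq_abs, abs_mul, abs_of_nonneg (Kato.katoDensity_pos hβ0 hβ1 m2 hs).le]

/-- Measurability of `s ↦ |∇^lΓ_j(c)(s)|ρ(s,m²)` in `ℝ≥0∞`. [folklore] -/
theorem measurable_ofReal_abs_latGrad_Gam_mul (L : ℝ) (β m2 : ℝ) (j : ℕ) (l : List (Site d))
    (c : Site d) :
    Measurable fun s : ℝ => ENNReal.ofReal (|latGrad l (Gam d L s j) c| * Kato.katoDensity β m2 s) :=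
  ((continuous_abs.measurable.comp (measurable_latGrad (F := fun s b => Gam d L s j b)
    (fun b => measurable_Gam L j b) l c)).mul (Kato.measurable_katoDensity β m2)).ennreal_ofReal

/-- **Tonelli: `∫₀^∞|∇^lΓ_{N,N}(π(·),y)(a)(s)|ρ ds ≤ Σ_zΣ_{j≥N}∫₀^∞|∇^lΓ_j(a-ỹ-Mz)(s)|ρ ds`** (in
`ℝ≥0∞`). [cite: Slade2017, §10.1 (proof of (10.4), first display, with ∇^a)] -/
theorem lintegral_abs_latGrad_GamNN_mul_le (hd : 1 ≤ d) {M : ℕ} [NeZero M] {β : ℝ} (hβ0 : 0 < β)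
    (hβ1 : β < 1) {L : ℝ} (hL : 1 < L) {m2 : ℝ} (hm2 : 0 < m2) {N : ℕ} (hN : 1 ≤ N)
    (l : List (Site d)) (a : Site d) (y : TorusSite d M) :
    ∫⁻ s in Ioi 0, ENNReal.ofReal (|latGrad l (fun b => GamNN d L s N M (Torus.proj M b) y) a| *
        Kato.katoDensity β m2 s) ≤
      ∑' z : Site d, ∑' m : ℕ, ENNReal.ofReal (∫ s in Ioi 0,
        |latGrad l (Gam d L s (m + N)) (a - (fun j => ((y j).val : ℤ) + M * z j))| *
          Kato.katoDensity β m2 s) := by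
  set c : Site d → Site d := fun z => a - (fun j => ((y j).val : ℤ) + M * z j) with hc
  calc ∫⁻ s in Ioi 0, ENNReal.ofReal (|latGrad l (fun b => GamNN d L s N M (Torus.proj M b) y) a| *
        Kato.katoDensity β m2 s)
      ≤ ∫⁻ s in Ioi 0, ∑' z : Site d, ∑' m : ℕ,
          ENNReal.ofReal (|latGrad l (Gam d L s (m + N)) (c z)| * Kato.katoDensity β m2 s) := by
        refine setLIntegral_mono' measurableSet_Ioi fun s hs => ?_
        have hs : (0 : ℝ) < s := hs
        have hρ0 := (Kato.katoDensity_pos hβ0 hβ1 m2 hs).le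
        rw [ENNReal.ofReal_mul (abs_nonneg _)]
        calc ENNReal.ofReal |latGrad l (fun b => GamNN d L s N M (Torus.proj M b) y) a| *
              ENNReal.ofReal (Kato.katoDensity β m2 s)
            ≤ (∑' z : Site d, ∑' m : ℕ, ENNReal.ofReal |latGrad l (Gam d L s (m + N)) (c z)|) *
                ENNReal.ofReal (Kato.katoDensity β m2 s) :=
              mul_le_mul_of_nonneg_right (ofReal_abs_latGrad_GamNN_le hd hL hs hN l a y) bot_le
          _ = ∑' z : Site d, ∑' m : ℕ,
                ENNReal.ofReal |latGrad l (Gam d L s (m + N)) (c z)| *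
                  ENNReal.ofReal (Kato.katoDensity β m2 s) := by
              rw [← ENNReal.tsum_mul_right]
              refine tsum_congr fun z => ?_
              rw [← ENNReal.tsum_mul_right]
          _ = ∑' z : Site d, ∑' m : ℕ,
                ENNReal.ofReal (|latGrad l (Gam d L s (m + N)) (c z)| * Kato.katoDensity β m2 s) := by
              refine tsum_congr fun z => tsum_congr fun m => ?_
              rw [ENNReal.ofReal_mul (abs_nonneg _)]
    _ = ∑' z : Site d, ∫⁻ s in Ioi 0, ∑' m : ℕ,
          ENNReal.ofReal (|latGrad l (Gam d L s (m + N)) (c z)| * Kato.katoDensity β m2 s) :=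
        lintegral_tsum fun z => (Measurable.tsum fun m =>
          measurable_ofReal_abs_latGrad_Gam_mul L β m2 (m + N) l (c z)).aemeasurable
    _ = ∑' z : Site d, ∑' m : ℕ, ∫⁻ s in Ioi 0,
          ENNReal.ofReal (|latGrad l (Gam d L s (m + N)) (c z)| * Kato.katoDensity β m2 s) := by
        refine tsum_congr fun z => ?_
        exact lintegral_tsum fun m =>
          (measurable_ofReal_abs_latGrad_Gam_mul L β m2 (m + N) l (c z)).aemeasurable
    _ = _ := by
        refine tsum_congr fun z => tsum_congr fun m => ?_
        rw [← ofReal_integral_eq_lintegral_ofReal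
          (integrableOn_abs_latGrad_Gam_mul_katoDensity hd hβ0 hβ1 hL hm2 (by omega) l (c z))]
        refine (ae_restrict_iff' measurableSet_Ioi).2 (Eventually.of_forall fun s hs => ?_)
        have hs : (0 : ℝ) < s := hs
        exact mul_nonneg (abs_nonneg _) (Kato.katoDensity_pos hβ0 hβ1 m2 hs).le

/-- `s ↦ |∇^l_aΓ_{N,N}(π(a),y)(s)|ρ^{(β)}(s,m²)` is integrable on `(0,∞)` (`m² > 0`), and
`∇^l_a C_{N,N}(π(a),y) = ∫₀^∞ ∇^l_aΓ_{N,N}(π(a),y)(s) ρ ds`. [folklore] -/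
theorem latGrad_fracCovNN_proj (hd : 1 ≤ d) {M : ℕ} [NeZero M] {α : ℝ} (hα0 : 0 < α)
    (hα2 : α < 2) {L : ℝ} (hL : 1 < L) {m2 : ℝ} (hm2 : 0 < m2) {N : ℕ} (hN : 1 ≤ N)
    (l : List (Site d)) (a : Site d) (y : TorusSite d M) :
    IntegrableOn (fun s : ℝ => |latGrad l (fun b => GamNN d L s N M (Torus.proj M b) y) a| *
        Kato.katoDensity (α / 2) m2 s) (Ioi 0) ∧
      latGrad l (fun b => fracCovNN d L α m2 N M (Torus.proj M b) y) a =
        ∫ s in Ioi 0, latGrad l (fun b => GamNN d L s N M (Torus.proj M b) y) a *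
          Kato.katoDensity (α / 2) m2 s := by
  have hβ0 : 0 < α / 2 := by positivity
  have hβ1 : α / 2 < 1 := by linarith
  set F : Site d → ℝ → ℝ := fun b s => GamNN d L s N M (Torus.proj M b) y * Kato.katoDensity (α / 2) m2 s
    with hF
  have hFi : ∀ b, Integrable (F b) ((volume : Measure ℝ).restrict (Ioi 0)) :=
    fun b => integrableOn_GamNN_mul_katoDensity hd hβ0 hβ1 hL hm2 hN (Torus.proj M b) y
  obtain ⟨h1, h2⟩ := latGrad_integral hFi l
  have hpt : ∀ s : ℝ, latGrad l (fun b => F b s) a =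
      latGrad l (fun b => GamNN d L s N M (Torus.proj M b) y) a * Kato.katoDensity (α / 2) m2 s := by
    intro s
    have e : (fun b => F b s) = fun b => Kato.katoDensity (α / 2) m2 s * GamNN d L s N M (Torus.proj M b) y := by
      funext b
      simp only [hF]
      ring
    rw [e, latGrad_const_mul, mul_comm]
  have hint : IntegrableOn (fun s : ℝ => latGrad l (fun b => GamNN d L s N M (Torus.proj M b) y) a *
      Kato.katoDensity (α / 2) m2 s) (Ioi 0) := (h1 a).congr (Eventually.of_forall hpt)
  refine ⟨?_, ?_⟩
  · refine (hint.norm).congr ?_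
    refine (ae_restrict_iff' measurableSet_Ioi).2 (Eventually.of_forall fun s hs => ?_)
    have hs : (0 : ℝ) < s := hs
    simp only
    rw [Real.norm_eq_abs, abs_mul, abs_of_nonneg (Kato.katoDensity_pos hβ0 hβ1 m2 hs).le]
  · have hC : (fun b => fracCovNN d L α m2 N M (Torus.proj M b) y) = fun b => ∫ s in Ioi 0, F b s := by
      funext b
      rfl
    rw [hC, h2 a]
    exact integral_congr_ae (Eventually.of_forall hpt)

/-! ### Counting translates -/

/-- **The number of `z ∈ ℤ^d` with `|w-Mz|₁ < r` is at most `(2r/M+1)^d`**, for any `w ∈ ℤ^d`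
(each coordinate `z_i` lies in an interval of length `2r/M`); finiteness included.
[cite: Slade2017, §10.1 (proof of (10.4): the factor L^{d(j-N)})] -/
theorem card_translates_lt_le {M : ℕ} [NeZero M] (w : Site d) {r : ℝ} (hr : 0 ≤ r) :
    ∃ S : Finset (Site d), (∀ z : Site d, (((∑ i, ((w - fun j => (M : ℤ) * z j) i).natAbs : ℕ) : ℝ)) < r →
      z ∈ S) ∧ ((S.card : ℕ) : ℝ) ≤ (2 * r / M + 1) ^ d := by
  classical
  have hM : (0 : ℝ) < M := by exact_mod_cast Nat.pos_of_ne_zero (NeZero.ne M)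
  set lo : Fin d → ℤ := fun i => ⌈((w i : ℝ) - r) / M⌉ with hlo
  set hi : Fin d → ℤ := fun i => ⌊((w i : ℝ) + r) / M⌋ with hhi
  set T : Finset (Site d) := Fintype.piFinset fun i => Finset.Icc (lo i) (hi i) with hT
  refine ⟨T, fun z hz => ?_, ?_⟩
  · rw [hT, Fintype.mem_piFinset]
    intro i
    have h1 : ((((w - fun j => (M : ℤ) * z j) i).natAbs : ℕ) : ℝ) < r := by
      refine lt_of_le_of_lt ?_ hz
      exact_mod_cast Finset.single_le_sum (f := fun k => ((w - fun j => (M : ℤ) * z j) k).natAbs)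
        (fun k _ => Nat.zero_le _) (Finset.mem_univ i)
    have h2 : ((w - fun j => (M : ℤ) * z j) i) = w i - M * z i := by simp only [Pi.sub_apply]
    rw [h2, ← Int.cast_natCast, Int.natCast_natAbs, Int.cast_abs] at h1
    have h3 : |((w i - M * z i : ℤ) : ℝ)| < r := h1
    rw [abs_lt] at h3
    push_cast at h3
    obtain ⟨h3a, h3b⟩ := h3
    rw [Finset.mem_Icc]
    constructor
    · rw [hlo, Int.ceil_le, div_le_iff₀ hM]
      nlinarith
    · rw [hhi, Int.le_floor, le_div_iff₀ hM]
      nlinarith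
  · rw [hT, Fintype.card_piFinset]
    push_cast
    have hprod : (2 * r / M + 1) ^ d = ∏ _i : Fin d, (2 * r / M + 1) := by
      rw [Finset.prod_const, Finset.card_univ, Fintype.card_fin]
    rw [hprod]
    refine Finset.prod_le_prod (fun i _ => by positivity) fun i _ => ?_
    rw [Int.card_Icc]
    have hlo' : ((w i : ℝ) - r) / M ≤ (lo i : ℝ) := Int.le_ceil _
    have hhi' : (hi i : ℝ) ≤ ((w i : ℝ) + r) / M := Int.floor_le _
    have hlen : ((hi i : ℝ) + 1 - lo i) ≤ 2 * r / M + 1 := by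
      have : ((w i : ℝ) + r) / M - ((w i : ℝ) - r) / M = 2 * r / M := by ring
      linarith
    rcases le_or_gt (hi i + 1 - lo i) 0 with hneg | hpos
    · rw [Int.toNat_of_nonpos hneg]
      simp only [CharP.cast_eq_zero]
      positivity
    · have : (((hi i + 1 - lo i).toNat : ℕ) : ℝ) = ((hi i + 1 - lo i : ℤ) : ℝ) := by
        rw [← Int.cast_natCast, Int.toNat_of_nonneg hpos.le]
      rw [this]
      push_cast
      exact hlen

/-! ### Proposition 3.3.1, estimate (3.10) with gradients -/

/-- **Slade, Proposition 3.3.1, estimate (3.10) = (10.4) with discrete gradients `∇^a`, PROVED**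
for the explicit [Baue13a]/BBS decomposition: for `d ≥ 1`, `n`, `α ∈ (0,2∧d)` and `m̄² > 0` there
is `c > 0` — independent of `m², L, N, a, y` and of the unit-step list `l` of length `n` — such
that for every integer `L ≥ 2`, every `m² ∈ (0,m̄²]`, every `N ≥ 1`, on the torus
`Λ_N = (ℤ/L^Nℤ)^d`, for all `a ∈ ℤ^d` and `y ∈ Λ_N`:
`|∇^l_a C_{N,N}(π(a),y)(m²)| ≤ c (L^{N-1})^{α-d-n} (m²(L^{N-1})^α)^{-2}`, i.e.
"`|∇^aC_{N,N;x,y}| ≤ cL^{-(d-α+|a|)(N-1)}(m²L^{α(N-1)})^{-2}`" (the torus gradient in `x` being the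
lattice gradient of the periodic lift `a ↦ C_{N,N}(π(a),y)`). Printed proof, followed:
`|∇^aC_{N,N}| ≤ Σ_zΣ_{j≥N}∫|∇^aΓ_j(a-ỹ-zL^N)|ρ` (Tonelli); by the finite range (enlarged by `|a|`
for the gradient) at most `((2|a|+1)(L^{j-N}+1))^d` translates contribute, each bounded by (10.3)
with `∇^a` at `p' = 2α` (second term dominated by `m̄²×` the first), and the geometric sum
`Σ_{j≥N}L^{d(j-N)}L^{-(j-1)(d+α+|a|)}`.
[cite: Slade2017, Proposition 3.3.1 (display (3.10), general a)] [cite: Slade2017, §10.1 (Proposition 10.1.1, display (10.4); proof "Assuming (10.3), we obtain (10.4) easily")] -/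
theorem Slade2017_prop331_CNN_grad_estimate (hd : 1 ≤ d) (n : ℕ) {α : ℝ} (hα0 : 0 < α)
    (hα2 : α < 2) (hαd : α < d) {mbar : ℝ} (hmbar : 0 < mbar) :
    ∃ c : ℝ, 0 < c ∧ ∀ l : List (Site d), l.length = n → (∀ e ∈ l, (∑ i, |((e i : ℤ) : ℝ)|) ≤ 1) →
      ∀ L : ℕ, 2 ≤ L → ∀ m2 : ℝ, 0 < m2 → m2 ≤ mbar → ∀ N : ℕ, 1 ≤ N →
      ∀ (M : ℕ) [NeZero M], M = L ^ N → ∀ (a : Site d) (y : TorusSite d M),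
        |latGrad l (fun b => fracCovNN d L α m2 N M (Torus.proj M b) y) a| ≤
          c * ((L : ℝ) ^ (N - 1)) ^ (α - d - n) * (m2 * ((L : ℝ) ^ (N - 1)) ^ α)⁻¹ ^ 2 := by
  have hβ0 : 0 < α / 2 := by positivity
  have hβ1 : α / 2 < 1 := by linarith
  obtain ⟨c₀, hc₀, hB⟩ :=
    Slade2017_prop331_grad_estimate_abs hd n hα0 hα2 hαd (p' := 2 * α) (by positivity)
  have h2α : (2 : ℝ) ^ (-α) < 1 := Real.rpow_lt_one_of_one_lt_of_neg (by norm_num) (by linarith)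
  have h2α0 : 0 < 1 - (2 : ℝ) ^ (-α) := by linarith
  obtain ⟨K, hK⟩ : ∃ K : ℝ,
      K = c₀ * (1 + mbar) * 2 ^ (d + n) * (2 * n + 1) ^ d / (1 - (2 : ℝ) ^ (-α)) := ⟨_, rfl⟩
  have hK0 : 0 < K := by rw [hK]; positivity
  refine ⟨K, hK0, fun l hl hl1 L hL m2 hm2 hm2' N hN M _ hM a y => ?_⟩
  have hBl := hB l hl hl1
  have hLr : (2 : ℝ) ≤ L := by exact_mod_cast hL
  have hLr1 : (1 : ℝ) < L := by linarith
  have hLr0 : (0 : ℝ) < L := by linarith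
  have hMr : (1 : ℝ) ≤ M := by exact_mod_cast Nat.pos_of_ne_zero (NeZero.ne M)
  have hDexp : ∀ u : ℝ, u ^ (α - d - n : ℝ) = u ^ (α - ((d + n : ℕ) : ℝ)) := fun u => by
    congr 1
    push_cast
    ring
  -- abbreviations (opaque)
  obtain ⟨c, hc⟩ : ∃ c : Site d → Site d, c = fun z => a - (fun j => ((y j).val : ℤ) + M * z j) :=
    ⟨_, rfl⟩
  have hcw : ∀ z, c z = (a - fun j => ((y j).val : ℤ)) - fun j => (M : ℤ) * z j := fun z => by
    rw [hc]
    funext j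
    simp only [Pi.sub_apply]
    ring
  obtain ⟨bnd, hbnd⟩ : ∃ bnd : ℕ → ℝ, bnd = fun m => c₀ * ((L : ℝ) ^ (m + N - 1)) ^ (α - ((d + n : ℕ) : ℝ)) *
      (1 / (1 + m2 ^ 2 * ((L : ℝ) ^ (m + N - 1)) ^ (2 * α)) +
        1 / (1 + m2 * ((L : ℝ) ^ (m + N - 1)) ^ (2 * α))) := ⟨_, rfl⟩
  have hbnd0 : ∀ m, 0 ≤ bnd m := fun m => by
    rw [hbnd]
    have h1 : 0 ≤ ((L : ℝ) ^ (m + N - 1)) ^ (α - ((d + n : ℕ) : ℝ)) :=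
      Real.rpow_nonneg (pow_nonneg hLr0.le _) _
    have h2 : 0 ≤ ((L : ℝ) ^ (m + N - 1)) ^ (2 * α) := Real.rpow_nonneg (pow_nonneg hLr0.le _) _
    positivity
  obtain ⟨G, hG⟩ : ∃ G : ℝ, G = c₀ * (1 + mbar) * 2 ^ (d + n) * (2 * n + 1) ^ d *
      (m2⁻¹ ^ 2 * ((L : ℝ) ^ (N - 1)) ^ (-(α + ((d + n : ℕ) : ℝ)))) := ⟨_, rfl⟩
  have hG0 : 0 ≤ G := by
    rw [hG]
    have := Real.rpow_nonneg (pow_nonneg hLr0.le (N - 1)) (-(α + ((d + n : ℕ) : ℝ)))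
    positivity
  obtain ⟨r, hr⟩ : ∃ r : ℝ, r = (L : ℝ) ^ (-α) := ⟨_, rfl⟩
  have hr0 : 0 ≤ r := by rw [hr]; exact Real.rpow_nonneg hLr0.le _
  have hr2 : r ≤ (2 : ℝ) ^ (-α) := by
    rw [hr]
    exact Real.rpow_le_rpow_of_nonpos (by norm_num) hLr (by linarith)
  have hr1 : r < 1 := lt_of_le_of_lt hr2 h2α
  -- Step 1: the real estimate of the summed bounds
  have hE : ∀ m, ((2 * n + 1) * ((L : ℝ) ^ m + 1)) ^ d * bnd m ≤ G * r ^ m := by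
    intro m
    have hℓ : 0 < (L : ℝ) ^ (m + N - 1) := pow_pos hLr0 _
    have ht := two_terms_le (d := d + n) hℓ (α := α) hm2 hm2'
    have hp := pow_count_le (d := d + n) hLr1.le α hN m
    have hLm1 : (1 : ℝ) ≤ (L : ℝ) ^ m + 1 := by
      have := pow_nonneg hLr0.le m
      linarith
    have hcount : ((2 * n + 1) * ((L : ℝ) ^ m + 1)) ^ d ≤ (2 * n + 1) ^ d * ((L : ℝ) ^ m + 1) ^ (d + n) := by
      rw [mul_pow]
      exact mul_le_mul_of_nonneg_left (pow_le_pow_right₀ hLm1 (by omega)) (by positivity)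
    have hfac : 0 ≤ (2 * (n : ℝ) + 1) ^ d * ((L : ℝ) ^ m + 1) ^ (d + n) := by positivity
    calc ((2 * n + 1) * ((L : ℝ) ^ m + 1)) ^ d * bnd m
        ≤ (2 * n + 1) ^ d * ((L : ℝ) ^ m + 1) ^ (d + n) * bnd m :=
          mul_le_mul_of_nonneg_right hcount (hbnd0 m)
      _ = c₀ * ((2 * n + 1) ^ d * (((L : ℝ) ^ m + 1) ^ (d + n) *
            (((L : ℝ) ^ (m + N - 1)) ^ (α - ((d + n : ℕ) : ℝ)) *
            (1 / (1 + m2 ^ 2 * ((L : ℝ) ^ (m + N - 1)) ^ (2 * α)) +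
              1 / (1 + m2 * ((L : ℝ) ^ (m + N - 1)) ^ (2 * α)))))) := by rw [hbnd]; ring
      _ ≤ c₀ * ((2 * n + 1) ^ d * (((L : ℝ) ^ m + 1) ^ (d + n) * ((1 + mbar) *
            (m2⁻¹ ^ 2 * ((L : ℝ) ^ (m + N - 1)) ^ (-(α + ((d + n : ℕ) : ℝ))))))) := by
          refine mul_le_mul_of_nonneg_left (mul_le_mul_of_nonneg_left
            (mul_le_mul_of_nonneg_left ht (by positivity)) (by positivity)) hc₀.le
      _ = c₀ * (1 + mbar) * (2 * n + 1) ^ d * m2⁻¹ ^ 2 *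
            (((L : ℝ) ^ m + 1) ^ (d + n) * ((L : ℝ) ^ (m + N - 1)) ^ (-(α + ((d + n : ℕ) : ℝ)))) := by
          ring
      _ ≤ c₀ * (1 + mbar) * (2 * n + 1) ^ d * m2⁻¹ ^ 2 *
            (2 ^ (d + n) * ((L : ℝ) ^ (-α)) ^ m * ((L : ℝ) ^ (N - 1)) ^ (-(α + ((d + n : ℕ) : ℝ)))) :=
          mul_le_mul_of_nonneg_left hp (by positivity)
      _ = G * r ^ m := by rw [hG, hr]; ring
  have hsumm : Summable fun m : ℕ => ((2 * n + 1) * ((L : ℝ) ^ m + 1)) ^ d * bnd m :=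
    Summable.of_nonneg_of_le (fun m => mul_nonneg (by positivity) (hbnd0 m)) hE
      ((summable_geometric_of_lt_one hr0 hr1).mul_left G)
  have htsum : ∑' m : ℕ, ((2 * n + 1) * ((L : ℝ) ^ m + 1)) ^ d * bnd m ≤ G / (1 - (2 : ℝ) ^ (-α)) := by
    calc ∑' m : ℕ, ((2 * n + 1) * ((L : ℝ) ^ m + 1)) ^ d * bnd m ≤ ∑' m : ℕ, G * r ^ m :=
          hsumm.tsum_le_tsum hE ((summable_geometric_of_lt_one hr0 hr1).mul_left G)
      _ = G * (1 - r)⁻¹ := by rw [tsum_mul_left, tsum_geometric_of_lt_one hr0 hr1]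
      _ ≤ G / (1 - (2 : ℝ) ^ (-α)) := by
          rw [div_eq_mul_inv]
          exact mul_le_mul_of_nonneg_left (inv_anti₀ h2α0 (by linarith)) hG0
  -- the target in terms of `G`
  have htarget : G / (1 - (2 : ℝ) ^ (-α)) =
      K * ((L : ℝ) ^ (N - 1)) ^ (α - d - n) * (m2 * ((L : ℝ) ^ (N - 1)) ^ α)⁻¹ ^ 2 := by
    have hℓ0 : 0 < (L : ℝ) ^ (N - 1) := pow_pos hLr0 _
    have hpow : ((L : ℝ) ^ (N - 1)) ^ (-(α + ((d + n : ℕ) : ℝ))) =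
        ((L : ℝ) ^ (N - 1)) ^ (α - d - n) * (((L : ℝ) ^ (N - 1)) ^ α)⁻¹ ^ 2 := by
      rw [inv_pow, ← Real.rpow_natCast (((L : ℝ) ^ (N - 1)) ^ α) 2, ← Real.rpow_mul hℓ0.le,
        ← Real.rpow_neg hℓ0.le, ← Real.rpow_add hℓ0]
      congr 1
      push_cast
      ring
    rw [hG, hK, hpow, mul_inv, mul_pow]
    ring
  -- Step 2: the `ℝ≥0∞` chain
  have hzero : ∀ (s : ℝ), 0 < s → ∀ (j : ℕ) (w : Site d),
      (L : ℝ) ^ j / 2 + n ≤ (((∑ i, (w i).natAbs : ℕ) : ℝ)) → latGrad l (Gam d L s j) w = 0 := by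
    intro s hs j w hw
    have h := latGrad_eq_zero_of_le (fun b hb => Gam_eq_zero hd hLr0.le hs.le j b hb) l hl1 w
    rw [hl] at h
    exact h hw
  have hI : ∀ z m, ∫ s in Ioi 0, |latGrad l (Gam d L s (m + N)) (c z)| * Kato.katoDensity (α / 2) m2 s ≤
      (if (((∑ i, ((c z) i).natAbs : ℕ) : ℝ)) < (L : ℝ) ^ (m + N) / 2 + n then bnd m else 0) := by
    intro z m
    split_ifs with hz
    · have h := hBl L hLr m2 hm2.le (m + N) (by omega) (c z)
      rw [hDexp] at h
      rw [hbnd]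
      exact h
    · have h0 : EqOn (fun s : ℝ => |latGrad l (Gam d L s (m + N)) (c z)| * Kato.katoDensity (α / 2) m2 s)
          (fun _ => 0) (Ioi 0) := fun s hs => by
        simp only
        rw [hzero s hs (m + N) (c z) (not_lt.1 hz), abs_zero, zero_mul]
      rw [setIntegral_congr_fun measurableSet_Ioi h0, integral_zero]
  have hZ : ∀ m, ∑' z : Site d, ENNReal.ofReal
      (if (((∑ i, ((c z) i).natAbs : ℕ) : ℝ)) < (L : ℝ) ^ (m + N) / 2 + n then bnd m else 0) ≤
        ENNReal.ofReal (((2 * n + 1) * ((L : ℝ) ^ m + 1)) ^ d * bnd m) := by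
    intro m
    obtain ⟨S, hS, hcard⟩ := card_translates_lt_le (M := M) (a - fun j => ((y j).val : ℤ))
      (r := (L : ℝ) ^ (m + N) / 2 + n) (by positivity)
    have hmem : ∀ z : Site d, (((∑ i, ((c z) i).natAbs : ℕ) : ℝ)) < (L : ℝ) ^ (m + N) / 2 + n → z ∈ S :=
      fun z hz => hS z (by rwa [hcw] at hz)
    rw [tsum_eq_sum (s := S) (fun z hz => by
      rw [if_neg (fun h => hz (hmem z h)), ENNReal.ofReal_zero])]
    have hle : ∀ z ∈ S, ENNReal.ofReal
        (if (((∑ i, ((c z) i).natAbs : ℕ) : ℝ)) < (L : ℝ) ^ (m + N) / 2 + n then bnd m else 0) ≤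
          ENNReal.ofReal (bnd m) := by
      intro z _
      split_ifs
      · exact le_rfl
      · rw [ENNReal.ofReal_zero]
        exact bot_le
    refine (Finset.sum_le_sum hle).trans ?_
    rw [Finset.sum_const, nsmul_eq_mul]
    have hradius : 2 * ((L : ℝ) ^ (m + N) / 2 + n) / M + 1 ≤ (2 * n + 1) * ((L : ℝ) ^ m + 1) := by
      have hM0 : (0 : ℝ) < M := by linarith
      have e1 : 2 * ((L : ℝ) ^ (m + N) / 2 + n) / M = (L : ℝ) ^ m + 2 * n / M := by
        rw [hM]
        push_cast
        rw [pow_add]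
        field_simp
      rw [e1]
      have h2n : 2 * (n : ℝ) / M ≤ 2 * n := by
        rw [div_le_iff₀ hM0]
        have : (0 : ℝ) ≤ 2 * n := by positivity
        nlinarith
      have hLm : (0 : ℝ) ≤ (L : ℝ) ^ m := pow_nonneg hLr0.le m
      nlinarith
    have hcard' : ((S.card : ℕ) : ℝ) ≤ ((2 * n + 1) * ((L : ℝ) ^ m + 1)) ^ d :=
      hcard.trans (pow_le_pow_left₀ (by positivity) hradius d)
    calc (S.card : ℝ≥0∞) * ENNReal.ofReal (bnd m)
        = ENNReal.ofReal (S.card : ℝ) * ENNReal.ofReal (bnd m) := by rw [ENNReal.ofReal_natCast]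
      _ ≤ ENNReal.ofReal (((2 * n + 1) * ((L : ℝ) ^ m + 1)) ^ d) * ENNReal.ofReal (bnd m) :=
          mul_le_mul_of_nonneg_right (ENNReal.ofReal_le_ofReal hcard') bot_le
      _ = ENNReal.ofReal (((2 * n + 1) * ((L : ℝ) ^ m + 1)) ^ d * bnd m) :=
          (ENNReal.ofReal_mul (by positivity)).symm
  have hchain : ∫⁻ s in Ioi 0, ENNReal.ofReal (|latGrad l (fun b => GamNN d L s N M (Torus.proj M b) y) a| *
      Kato.katoDensity (α / 2) m2 s) ≤ ENNReal.ofReal (G / (1 - (2 : ℝ) ^ (-α))) := by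
    calc ∫⁻ s in Ioi 0, ENNReal.ofReal (|latGrad l (fun b => GamNN d L s N M (Torus.proj M b) y) a| *
          Kato.katoDensity (α / 2) m2 s)
        ≤ ∑' z : Site d, ∑' m : ℕ, ENNReal.ofReal (∫ s in Ioi 0,
            |latGrad l (Gam d L s (m + N)) (c z)| * Kato.katoDensity (α / 2) m2 s) := by
          rw [hc]
          exact lintegral_abs_latGrad_GamNN_mul_le hd hβ0 hβ1 hLr1 hm2 hN l a y
      _ ≤ ∑' z : Site d, ∑' m : ℕ, ENNReal.ofReal
            (if (((∑ i, ((c z) i).natAbs : ℕ) : ℝ)) < (L : ℝ) ^ (m + N) / 2 + n then bnd m else 0) :=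
          ENNReal.tsum_le_tsum fun z => ENNReal.tsum_le_tsum fun m => ENNReal.ofReal_le_ofReal (hI z m)
      _ = ∑' m : ℕ, ∑' z : Site d, ENNReal.ofReal
            (if (((∑ i, ((c z) i).natAbs : ℕ) : ℝ)) < (L : ℝ) ^ (m + N) / 2 + n then bnd m else 0) :=
          ENNReal.tsum_comm
      _ ≤ ∑' m : ℕ, ENNReal.ofReal (((2 * n + 1) * ((L : ℝ) ^ m + 1)) ^ d * bnd m) :=
          ENNReal.tsum_le_tsum hZ
      _ = ENNReal.ofReal (∑' m : ℕ, ((2 * n + 1) * ((L : ℝ) ^ m + 1)) ^ d * bnd m) :=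
          (ENNReal.ofReal_tsum_of_nonneg (fun m => mul_nonneg (by positivity) (hbnd0 m)) hsumm).symm
      _ ≤ ENNReal.ofReal (G / (1 - (2 : ℝ) ^ (-α))) := ENNReal.ofReal_le_ofReal htsum
  -- Step 3: back to `ℝ`
  obtain ⟨hint, hrepC⟩ := latGrad_fracCovNN_proj hd hα0 hα2 hLr1 hm2 hN l a y
  have hnn : 0 ≤ᵐ[(volume : Measure ℝ).restrict (Ioi 0)]
      fun s : ℝ => |latGrad l (fun b => GamNN d L s N M (Torus.proj M b) y) a| * Kato.katoDensity (α / 2) m2 s :=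
    (ae_restrict_iff' measurableSet_Ioi).2 (Eventually.of_forall fun s hs =>
      mul_nonneg (abs_nonneg _) (Kato.katoDensity_pos hβ0 hβ1 m2 hs).le)
  rw [hrepC]
  calc |∫ s in Ioi 0, latGrad l (fun b => GamNN d L s N M (Torus.proj M b) y) a * Kato.katoDensity (α / 2) m2 s|
      ≤ ∫ s in Ioi 0, |latGrad l (fun b => GamNN d L s N M (Torus.proj M b) y) a *
          Kato.katoDensity (α / 2) m2 s| := abs_integral_le_integral_abs
    _ = ∫ s in Ioi 0, |latGrad l (fun b => GamNN d L s N M (Torus.proj M b) y) a| *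
          Kato.katoDensity (α / 2) m2 s := by
        refine setIntegral_congr_fun measurableSet_Ioi fun s hs => ?_
        rw [abs_mul, abs_of_nonneg (Kato.katoDensity_pos hβ0 hβ1 m2 hs).le]
    _ = (∫⁻ s in Ioi 0, ENNReal.ofReal (|latGrad l (fun b => GamNN d L s N M (Torus.proj M b) y) a| *
          Kato.katoDensity (α / 2) m2 s)).toReal :=
        integral_eq_lintegral_of_nonneg_ae hnn hint.aestronglyMeasurable
    _ ≤ G / (1 - (2 : ℝ) ^ (-α)) :=
        ENNReal.toReal_le_of_le_ofReal (div_nonneg hG0 h2α0.le) hchain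
    _ = K * ((L : ℝ) ^ (N - 1)) ^ (α - d - n) * (m2 * ((L : ℝ) ^ (N - 1)) ^ α)⁻¹ ^ 2 := htarget

end FRD

end LongRangePhi4

end Literature.Barriers.CriticalPhenomena
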